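import Summits.HodgeConjecture.HodgeConjecture.Theses.NikulinTwinTransport
import Literature.AlgebraicGeometry.Surfaces.K3PeriodSurjectivity

/-!
# Sketch — crux-ideate round 1, ideator 2, crux `HodgeSimilitudeAlgebraic` (stmt-HodgeConjecture-13676)

First lemmas of the idea cards `Ideas/semiregular-hecke-twin.md` (card A) and
`Ideas/supersingular-twin-anchor.md` (card B), stated over existing declarations only.
Nothing here is filed; provers never see this file.
-/

noncomputable section

open scoped Manifold
open CategoryTheory
open Literature.AlgebraicTopology.SingularHomology
open Literature.AlgebraicGeometry
open Literature.AlgebraicGeometry.HodgeTheory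
open Literature.AlgebraicGeometry.Surfaces

namespace Summit.HodgeConjecture.HodgeConjecture.Cruxes.HodgeSimilitudeAlgebraic.Ideas

/-- The K3 hypothesis exactly as unfolded in the route file (the body of `IsK3Surface`). -/
def K3Hyp (S : Motives.SchemeOver ℂ) : Prop :=
  Motives.IsSmoothProjective 2 S ∧ Subsingleton (Motives.structureSheafCohomology S.left 1) ∧
    ∃ (A : HodgeModel 2 S) (η : Literature.Geometry.Kaehler.MForm 𝓘(ℝ, A.model) A.carrier ℂ 2),
      Literature.Geometry.Kaehler.IsHolomorphicInCharts η ∧ ∀ x, η x ≠ 0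

theorem k3Hyp_iff (S : Motives.SchemeOver ℂ) : K3Hyp S ↔ IsK3Surface S := Iff.rfl

/-- `p` is an integral generator of `H⁴(S(ℂ))`. -/
def IsIntGen {S : Motives.SchemeOver ℂ} (p : complexBetti S (2 * 2)) : Prop :=
  IsIntegralClass p ∧ ∀ q : complexBetti S (2 * 2), IsIntegralClass q → ∃ n : ℤ, q = n • p

/-- `ψ : H²(S') → H²(S)` is rational, type-preserving and a similitude of multiplier `r`
(the three hypotheses of the crux, bundled). -/
def IsHodgeSimilitude {S S' : Motives.SchemeOver ℂ} (p : complexBetti S (2 * 2))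
    (p' : complexBetti S' (2 * 2)) (r : ℚ)
    (ψ : complexBetti S' (2 * 1) →ₗ[ℂ] complexBetti S (2 * 1)) : Prop :=
  (∀ x, IsRationalClass x → IsRationalClass (ψ x)) ∧
  (∀ (i j : ℕ) x, IsOfHodgeType 2 S' (2 * 1) i j x → IsOfHodgeType 2 S (2 * 1) i j (ψ x)) ∧
  (∀ (x y : complexBetti S' (2 * 1)) (a : ℂ),
      cupProduct (rfl : 2 * 1 + 2 * 1 = 2 * 2) x y = a • p' →
        cupProduct (rfl : 2 * 1 + 2 * 1 = 2 * 2) (ψ x) (ψ y) = ((r : ℂ) * a) • p)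

/-- `ψ = [γ]_* = fst_*(snd^*(–) ∪ γ)` for an algebraic codimension-2 class `γ` on `S × S'`
(the conclusion of the crux). -/
def IsAlgebraicOn (μ : OrientationFamily) {S S' : Motives.SchemeOver ℂ} (hS : K3Hyp S)
    (hS' : K3Hyp S') (ψ : complexBetti S' (2 * 1) →ₗ[ℂ] complexBetti S (2 * 1)) : Prop :=
  ∃ γ ∈ algebraicClasses (MonoidalCategoryStruct.tensorObj S S') 2,
    ∀ x : complexBetti S' (2 * 1),
      ψ x = complexGysin μ (Motives.IsSmoothProjective.tensor_holds hS.1 hS'.1) hS.1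
        (SemiCartesianMonoidalCategory.fst S S')
        (rfl : 2 * 1 + 2 * 2 + 2 * 2 = 2 * 1 + 2 * (2 + 2))
        (cupProduct (rfl : 2 * 1 + 2 * 2 = 2 * 1 + 2 * 2)
          (complexBetti.map (SemiCartesianMonoidalCategory.snd S S') (2 * 1) x) γ)

/-- The crux at ONE multiplier `r`. -/
def SimAlgAt (r : ℚ) : Prop :=
  ∀ (μ : OrientationFamily), μ.HasPoincareDuality →
    ∀ (S S' : Motives.SchemeOver ℂ) (hS : K3Hyp S) (hS' : K3Hyp S')
      (p : complexBetti S (2 * 2)) (p' : complexBetti S' (2 * 2)),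
      IsIntGen p → IsIntGen p' →
      ∀ ψ : complexBetti S' (2 * 1) →ₗ[ℂ] complexBetti S (2 * 1),
        IsHodgeSimilitude p p' r ψ → IsAlgebraicOn μ hS hS' ψ

/-- The crux is `∀ r > 0, SimAlgAt r` (currying only). -/
theorem hodgeSimilitudeAlgebraic_iff :
    Theses.NikulinTwinTransport.HodgeSimilitudeAlgebraic ↔ ∀ r : ℚ, 0 < r → SimAlgAt r :=
  ⟨fun h r hr μ hμ S S' hS hS' p p' hp hp' ψ hψ =>
      h r hr μ hμ S S' hS hS' p p' hp hp' ψ hψ.1 hψ.2.1 hψ.2.2,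
    fun h r hr μ hμ S S' hS hS' p p' hp hp' ψ h1 h2 h3 =>
      h r hr μ hμ S S' hS hS' p p' hp hp' ψ ⟨h1, h2, h3⟩⟩

/-! ### Card A (`semiregular-hecke-twin`), first lemma: prime anchors -/

/-- **PrimeAnchorsExist** — for every prime `p` there is a pair of projective K3 surfaces carrying
an ALGEBRAIC rational Hodge similitude of multiplier `p` (Kummer `p`-isogeny anchors
`Km(E₁×E₂) ⇢ Km(E₁'×E₂)`, `E₁ → E₁'` cyclic of degree `p`: the transcendental part of the graph
closure, completed on `NS` by Witt). This is the anchor half of line A; the transport half is the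
semiregular deformation along the Hecke-twin family. -/
def PrimeAnchorsExist : Prop :=
  ∀ p : ℕ, p.Prime →
    ∀ (μ : OrientationFamily), μ.HasPoincareDuality →
      ∃ (S S' : Motives.SchemeOver ℂ) (hS : K3Hyp S) (hS' : K3Hyp S')
        (q : complexBetti S (2 * 2)) (q' : complexBetti S' (2 * 2))
        (ψ : complexBetti S' (2 * 1) →ₗ[ℂ] complexBetti S (2 * 1)),
        IsIntGen q ∧ IsIntGen q' ∧ IsHodgeSimilitude q q' (p : ℚ) ψ ∧ Function.Injective ψ ∧
          IsAlgebraicOn μ hS hS' ψ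

/-- **SemiregularityTargetDim** — the numerology behind card A: for projective K3 surfaces
`S, S'` the target `H²(𝒪) ⊕ H³(Ω¹) ⊕ H⁴(Ω²)` of the Buchweitz–Flenner semiregularity map on
`X = S × S'` has dimension `2 + 40 + 2 = 44` (Künneth + `h^{1,1}(K3) = 20`), stated on the tree's
carriers as spans of classes of Hodge types `(0,2)`, `(1,3)`, `(2,4)`. -/
def SemiregularityTargetDim : Prop :=
  ∀ (S S' : Motives.SchemeOver ℂ), K3Hyp S → K3Hyp S' →
    Module.finrank ℂ (Submodule.span ℂ
        {c : complexBetti (MonoidalCategoryStruct.tensorObj S S') 2 |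
          IsOfHodgeType 4 (MonoidalCategoryStruct.tensorObj S S') 2 0 2 c}) = 2 ∧
    Module.finrank ℂ (Submodule.span ℂ
        {c : complexBetti (MonoidalCategoryStruct.tensorObj S S') 4 |
          IsOfHodgeType 4 (MonoidalCategoryStruct.tensorObj S S') 4 1 3 c}) = 40 ∧
    Module.finrank ℂ (Submodule.span ℂ
        {c : complexBetti (MonoidalCategoryStruct.tensorObj S S') 6 |
          IsOfHodgeType 4 (MonoidalCategoryStruct.tensorObj S S') 6 2 4 c}) = 2

/-! ### Card B (`supersingular-twin-anchor`), first lemma: twins of every multiplier -/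

/-- `TwinExistsAt d`: every projective K3 surface has a projective K3 partner with a rational,
type-preserving similitude of multiplier `d` (the route's `TwinExists` is `d = 2`). -/
def TwinExistsAt (d : ℚ) : Prop :=
  ∀ (S : Motives.SchemeOver ℂ), K3Hyp S →
    ∃ (S' : Motives.SchemeOver ℂ) (p : complexBetti S (2 * 2)) (p' : complexBetti S' (2 * 2))
      (ψ : complexBetti S' (2 * 1) →ₗ[ℂ] complexBetti S (2 * 1)),
      K3Hyp S' ∧ IsIntGen p ∧ IsIntGen p' ∧ IsHodgeSimilitude p p' d ψ

/-- **TwinsOfEveryMultiplier** — the Hecke-twin family of multiplier `d` passes through every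
projective K3 surface, for every rational `d > 0`. With Buskin (`HodgeIsometryAlgebraic`) this
reduces the crux to ONE model similitude `M_d` per `d`, i.e. to the flat section `graph(M_d)` over
the algebraic Hecke-twin family — the object both cards transport. -/
def TwinsOfEveryMultiplier : Prop :=
  ∀ d : ℚ, 0 < d → TwinExistsAt d

/-- **SimilitudePreservesProjectivePeriods** — lattice core of `TwinsOfEveryMultiplier` and of the
Hecke-twin family (generalises `k3PeriodHypotheses_k3ReflectionC` from reflections to rational
similitudes): a rational similitude `M` of `Λ_{K3} ⊗ ℚ` of multiplier `d > 0` carries period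
vectors satisfying the hypotheses of `Huybrechts_K3_periodSurjective_projective` to period vectors
satisfying them (`(Mx.Mx) = d(x.x)`, `M` is real, and `M` of a positive lattice vector in `x^⊥` is
a positive RATIONAL vector in `(Mx)^⊥`, a multiple of which is in `Λ`). Provable now. -/
def SimilitudePreservesProjectivePeriods : Prop :=
  ∀ (M : Matrix K3Index K3Index ℚ) (d : ℚ), 0 < d →
    M.transpose * k3Gram.map (Int.cast : ℤ → ℚ) * M = d • k3Gram.map (Int.cast : ℤ → ℚ) →
    ∀ x : K3Index → ℂ, k3Form x x = 0 → 0 < (k3Form (star x) x).re →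
      (∃ v : K3Index → ℤ, k3Form (fun i => (v i : ℂ)) x = 0 ∧
        0 < ∑ i, ∑ j, v i * k3Gram i j * v j) →
      k3Form ((M.map (Rat.cast : ℚ → ℂ)).mulVec x) ((M.map (Rat.cast : ℚ → ℂ)).mulVec x) = 0 ∧
      0 < (k3Form (star ((M.map (Rat.cast : ℚ → ℂ)).mulVec x))
        ((M.map (Rat.cast : ℚ → ℂ)).mulVec x)).re ∧
      ∃ v : K3Index → ℤ, k3Form (fun i => (v i : ℂ)) ((M.map (Rat.cast : ℚ → ℂ)).mulVec x) = 0 ∧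
        0 < ∑ i, ∑ j, v i * k3Gram i j * v j

/-- **PrimesSuffice** — the multiplicative bookkeeping both cards start from: multipliers of
algebraic similitudes are closed under products and contain the squares (compose with a twin,
divide by the multiplier, use Buskin for the resulting isometry; composition and transpose of
algebraic correspondences on the real carriers, Fulton Ch. 16), so the crux follows from its prime
instances, twins of every multiplier and `HodgeIsometryAlgebraic`. -/
def PrimesSuffice : Prop :=
  (∀ p : ℕ, p.Prime → SimAlgAt p) → TwinsOfEveryMultiplier →
    Theses.NikulinTwinTransport.HodgeIsometryAlgebraic →
      Theses.NikulinTwinTransport.HodgeSimilitudeAlgebraic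

end Summit.HodgeConjecture.HodgeConjecture.Cruxes.HodgeSimilitudeAlgebraic.Ideas

end
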